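import Summits.BirchSwinnertonDyer.BirchSwinnertonDyer.Theorems.SignedLowerHalvesSmallImageLowerHalfBothSignsRttD2J2Specialisation
import HarnessLib

/-!
# Route `SignedLowerHalves`, crux L `SmallImageLowerHalfBothSigns` (stmt-BirchSwinnertonDyer-23599), line `rtt_w3` v15 act (LEAD): the untwisted specialisation
# `φ₀ : Λ_{𝒪,2} → Λ_𝒪` (`T₂ ↦ 0`) satisfies the road-D frame clauses at `b = 0`: `φ₀ (C (X − C 0)) = 0`, `φ₀ (C (C c)) = C c`, `ker φ₀ = (C (X − C 0))`

WHY (RULING «U»: `b := 0`; the consumer `charRoad_E2_of_depleted_junction_tails` p784278 takes `φ hφf hC hφX hker`; honda's `phi0` p782440 is that `φ`). Pure algebra: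
`g ∈ ker φ₀ ⟺` every coefficient `a_n(T₂)` has constant term `0 ⟺ T₂ ∣ a_n ⟺ C T₂ ∣ g`.
THEOREMS ONLY (`--supports stmt-BirchSwinnertonDyer-23599` helper); closes nothing. [cite: JohnsonLeungKings2011, §4.1–§4.2] [folklore]
-/

set_option autoImplicit false
-- the Theorems namespace of this sub repeats the summit name by design (D-0017 nested layout)
set_option linter.dupNamespace false

noncomputable section

open Literature.NumberTheory.EllipticCurves Literature.NumberTheory.ComplexMultiplication.EllipticUnits

namespace Summit.BirchSwinnertonDyer.BirchSwinnertonDyer.Theorems.SmallImageRttD2J2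

variable {p : ℕ} [Fact p.Prime] (S : Set (PadicAlgCl p))

/-- `φ₀ (C (X − C 0)) = 0`. [folklore] -/
theorem phi0_C_X_sub_C_zero :
    phi0 S (PowerSeries.C (PowerSeries.X - PowerSeries.C (0 : padicCoeffIntegers S) : PowerSeries (padicCoeffIntegers S)) : IwasawaAlgebraO₂ S) = 0 := by
  rw [phi0_C, map_sub, PowerSeries.constantCoeff_X, PowerSeries.constantCoeff_C, sub_zero, map_zero]

/-- `φ₀ (C (C c)) = C c`. [folklore] -/
theorem phi0_C_C (c : padicCoeffIntegers S) :
    phi0 S (PowerSeries.C (PowerSeries.C c : PowerSeries (padicCoeffIntegers S)) : IwasawaAlgebraO₂ S) = PowerSeries.C c := by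
  rw [phi0_C, PowerSeries.constantCoeff_C]

/-- **`ker φ₀ = (C (X − C 0))`**: a power series over `𝒪⟦T₂⟧` all of whose coefficients have constant term `0` is divisible by `C T₂`. [folklore] -/
theorem ker_phi0 :
    RingHom.ker (phi0 S) =
      Ideal.span {(PowerSeries.C (PowerSeries.X - PowerSeries.C (0 : padicCoeffIntegers S) : PowerSeries (padicCoeffIntegers S)) : IwasawaAlgebraO₂ S)} := by
  have hX0 : (PowerSeries.X - PowerSeries.C (0 : padicCoeffIntegers S) : PowerSeries (padicCoeffIntegers S)) = PowerSeries.X := by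
    rw [map_zero, sub_zero]
  rw [hX0]
  apply le_antisymm
  · intro g hg
    rw [RingHom.mem_ker] at hg
    -- every coefficient of `g` has constant term `0`, hence is `X * b n`
    have hcoeff : ∀ n, PowerSeries.constantCoeff (PowerSeries.coeff n g) = 0 := fun n ↦ by
      have := congrArg (PowerSeries.coeff n) hg
      rwa [phi0, PowerSeries.coeff_map, map_zero] at this
    choose b hb using fun n ↦ (PowerSeries.X_dvd_iff.mpr (hcoeff n))
    -- `g = C X * (mk b)`
    have hg' : g = PowerSeries.C PowerSeries.X * PowerSeries.mk b := by
      ext n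
      rw [PowerSeries.coeff_C_mul, PowerSeries.coeff_mk, ← hb n]
    rw [hg']
    exact Ideal.mul_mem_right _ _ (Ideal.subset_span rfl)
  · rw [Ideal.span_le, Set.singleton_subset_iff, SetLike.mem_coe, RingHom.mem_ker, phi0_C, PowerSeries.constantCoeff_X, map_zero]

end Summit.BirchSwinnertonDyer.BirchSwinnertonDyer.Theorems.SmallImageRttD2J2

end
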